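import Literature.Geometry.Lorentzian.DataEmbeddingConstraints
import Literature.Geometry.Lorentzian.MaximalDataScalarCurvature
import HarnessLib

/-!
# The data of any spacelike leaf of a vacuum spacetime solve the constraints; maximal leaves have
# `R(h) = |k|²_h ≥ 0`

The tree's `InitialDataSet.isVacuumConstraintSolution_of_isVacuum` (`DataEmbeddingConstraints.lean`:
Choquet-Bruhat 2009, Ch. VI, Thm. 3.3, necessity of the constraints — twice-traced Gauss and traced
Codazzi equations) is stated for a `DataEmbedding D`, and `VacuumCauchyDevelopment` applies it to the
INITIAL slice `ι(X)` of a development. The statements of the final state conjecture's maximal-gauge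
route quantify instead over the LEAVES `f : X → M` of a foliation of a vacuum development by
smoothly embedded spacelike hypersurfaces with future unit normal `νf`, whose induced metric and
second fundamental form agree with an initial data set `Dt` on `X`
(`Summits/FinalStateConjecture/…/Theses/LapseTrumpetKID.lean`, clause (ii) of `MaximalCensorship`;
the negative lane `…/Theorems/MaximalCensorship/Negative/…`, hypothesis `NonPSCAdmissibleTopology`).
This file packages such a leaf as a data embedding of `Dt` and reads off:

* `Spacetime.leafDataEmbedding` — the data embedding `(M, g, τ, f, νf)` of `Dt` (the constructor of
  `DataEmbedding`, with `f^* g = h` converted from its pointwise form);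
* `VacuumCauchyDevelopment.isVacuumConstraintSolution_leaf` — **the data of every leaf of a vacuum
  Cauchy development solve the vacuum constraint equations** (no Cauchy-hypersurface hypothesis on
  the leaf is needed);
* `VacuumCauchyDevelopment.scalarCurvature_eq_normSqK_leaf`, `scalarCurvature_nonneg_leaf` —
  **a maximal (`tr k = 0`) leaf has `R(h) = |k|²_h ≥ 0`** (Isenberg–Mazzeo–Pollack, Ann. Henri
  Poincaré 4 (2003) 369, p. 371: "a CMC asymptotically Euclidean initial data set necessarily has
  `τ = 0`, so that (2) becomes `R = |Π|² ≥ 0`"; the pointwise sign with which the proof of their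
  Thm. 4 — no maximal asymptotically Euclidean Cauchy surface over a non-PSC closed `Σ` — begins).

With these, clause (B) of `NonPSCAdmissibleTopology` at a data manifold `X` is reduced to a purely
Riemannian statement about `X`: no complete initial data set on `X`, asymptotically flat of order
`1` at a sole end, has `R(h) = |k|²_h` (in particular `R(h) ≥ 0`) — for `X = T³ ∖ {p}` the
Schoen–Yau / IMP Thm. 4 obstruction, not formalised here. Everything is proved; no named facts.

## References

* Y. Choquet-Bruhat, *General Relativity and the Einstein Equations*, OUP 2009, Ch. VI, Thm. 3.3.
  [ChoquetBruhat2009]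
* J. Isenberg, R. Mazzeo, D. Pollack, *On the topology of vacuum spacetimes*, Ann. Henri Poincaré
  4 (2003) 369–383, p. 371 and Thm. 4. [IsenbergMazzeoPollack2002]
-/

noncomputable section

open Manifold Bundle Set
open scoped ContDiff

universe u

namespace Literature.Geometry.Lorentzian

variable {n : ℕ} {X : Type u} [TopologicalSpace X] [ChartedSpace (EuclideanSpace ℝ (Fin n)) X]
  [IsManifold (𝓡 n) ∞ X] [ConnectedSpace X]

namespace Spacetime

/-- **The data embedding of a leaf.** A spacetime `(M, g, τ)`, a smooth embedding `f : X → M`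
with a future unit normal `νf`, and an initial data set `Dt = (h, k)` on `X` with
`h_x(v, w) = g_{f x}(df v, df w)` and `K_{νf} = k` form a data embedding of `Dt` (this is the
constructor of `DataEmbedding`, the pointwise identity being `f^* g = h`). Choquet-Bruhat–Geroch,
CMP 14 (1969), p. 330; Ringström 2009, Def. 16.2. [cite: Ringstrom2009, Def. 16.2] -/
def leafDataEmbedding (𝓢 : Spacetime.{u} (n + 1)) (f : X → 𝓢.carrier)
    (νf : NormalField (𝓡 (n + 1)) f) (hEmb : Manifold.IsSmoothEmbedding (𝓡 n) (𝓡 (n + 1)) ∞ f)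
    (hNormal : 𝓢.metric.IsFutureUnitNormal (𝓡 n) 𝓢.timeOrientation f νf)
    (Dt : InitialDataSet (𝓡 n) X)
    (hh : ∀ (x : X) (v w : TangentSpace (𝓡 n) x), Dt.h.inner x v w =
      𝓢.metric.val (f x) (mfderiv (𝓡 n) (𝓡 (n + 1)) f x v) (mfderiv (𝓡 n) (𝓡 (n + 1)) f x w))
    (hk : ∀ [𝓢.metric.toPseudoRiemannianMetric.HasLeviCivita] (x : X),
      𝓢.metric.toPseudoRiemannianMetric.secondFundamentalForm (𝓡 n) f νf x = Dt.kBilin x) :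
    DataEmbedding Dt where
  toSpacetime := 𝓢
  embed := f
  isSmoothEmbedding := hEmb
  normal := νf
  isFutureUnitNormal := hNormal
  induced_h y := by
    ext v w
    exact (hh y v w).symm
  induced_k := hk

/-- The spacetime of the data embedding of a leaf is the ambient spacetime. [folklore] -/
@[simp] theorem leafDataEmbedding_toSpacetime (𝓢 : Spacetime.{u} (n + 1)) (f : X → 𝓢.carrier)
    (νf : NormalField (𝓡 (n + 1)) f) (hEmb : Manifold.IsSmoothEmbedding (𝓡 n) (𝓡 (n + 1)) ∞ f)
    (hNormal : 𝓢.metric.IsFutureUnitNormal (𝓡 n) 𝓢.timeOrientation f νf)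
    (Dt : InitialDataSet (𝓡 n) X)
    (hh : ∀ (x : X) (v w : TangentSpace (𝓡 n) x), Dt.h.inner x v w =
      𝓢.metric.val (f x) (mfderiv (𝓡 n) (𝓡 (n + 1)) f x v) (mfderiv (𝓡 n) (𝓡 (n + 1)) f x w))
    (hk : ∀ [𝓢.metric.toPseudoRiemannianMetric.HasLeviCivita] (x : X),
      𝓢.metric.toPseudoRiemannianMetric.secondFundamentalForm (𝓡 n) f νf x = Dt.kBilin x) :
    (𝓢.leafDataEmbedding f νf hEmb hNormal Dt hh hk).toSpacetime = 𝓢 :=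
  rfl

end Spacetime

namespace VacuumCauchyDevelopment

variable {D : InitialDataSet (𝓡 n) X}

/-- **The data of every leaf of a vacuum Cauchy development solve the vacuum constraint
equations.** Let `𝒟 = (M, g, τ, ι, ν)` be a vacuum Cauchy development of `D` and `f : X → M` a
smooth embedding with future unit normal `νf` whose induced metric and second fundamental form are
those of the initial data set `Dt` on `X`. Then `Dt` solves the vacuum constraints (Hamiltonian:
twice-traced Gauss equation; momentum: traced Codazzi equation; `Ric(g) = 0`). Choquet-Bruhat 2009,
Ch. VI, Thm. 3.3 (necessity of the constraints on any spacelike hypersurface); Wald 1984,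
(10.2.28)–(10.2.30). [cite: ChoquetBruhat2009, Ch. VI, Thm. 3.3] -/
theorem isVacuumConstraintSolution_leaf (𝒟 : VacuumCauchyDevelopment D) (f : X → 𝒟.carrier)
    (νf : NormalField (𝓡 (n + 1)) f) (hEmb : Manifold.IsSmoothEmbedding (𝓡 n) (𝓡 (n + 1)) ∞ f)
    (hNormal : 𝒟.metric.IsFutureUnitNormal (𝓡 n) 𝒟.timeOrientation f νf)
    (Dt : InitialDataSet (𝓡 n) X)
    (hh : ∀ (x : X) (v w : TangentSpace (𝓡 n) x), Dt.h.inner x v w =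
      𝒟.metric.val (f x) (mfderiv (𝓡 n) (𝓡 (n + 1)) f x v) (mfderiv (𝓡 n) (𝓡 (n + 1)) f x w))
    (hk : ∀ [𝒟.metric.toPseudoRiemannianMetric.HasLeviCivita] (x : X),
      𝒟.metric.toPseudoRiemannianMetric.secondFundamentalForm (𝓡 n) f νf x = Dt.kBilin x)
    [Dt.metric.HasLeviCivita] : Dt.IsVacuumConstraintSolution :=
  InitialDataSet.isVacuumConstraintSolution_of_isVacuum
    (𝒟.toSpacetime.leafDataEmbedding f νf hEmb hNormal Dt hh hk) (by
      unfold DataEmbedding.IsVacuum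
      intro i
      exact @VacuumCauchyDevelopment.isRicciFlat _ _ _ _ _ _ _ 𝒟 i)

/-- **A maximal leaf of a vacuum Cauchy development has `R(h) = |k|²_h`** pointwise (vacuum
constraints on the leaf, `isVacuumConstraintSolution_leaf`, with `tr_h k = 0`). Isenberg–Mazzeo–Pollack,
Ann. Henri Poincaré 4 (2003) 369, p. 371 ("so that (2) becomes `R = |Π|² ≥ 0`").
[cite: IsenbergMazzeoPollack2002, p. 371] -/
theorem scalarCurvature_eq_normSqK_leaf (𝒟 : VacuumCauchyDevelopment D) (f : X → 𝒟.carrier)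
    (νf : NormalField (𝓡 (n + 1)) f) (hEmb : Manifold.IsSmoothEmbedding (𝓡 n) (𝓡 (n + 1)) ∞ f)
    (hNormal : 𝒟.metric.IsFutureUnitNormal (𝓡 n) 𝒟.timeOrientation f νf)
    (Dt : InitialDataSet (𝓡 n) X)
    (hh : ∀ (x : X) (v w : TangentSpace (𝓡 n) x), Dt.h.inner x v w =
      𝒟.metric.val (f x) (mfderiv (𝓡 n) (𝓡 (n + 1)) f x v) (mfderiv (𝓡 n) (𝓡 (n + 1)) f x w))
    (hk : ∀ [𝒟.metric.toPseudoRiemannianMetric.HasLeviCivita] (x : X),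
      𝒟.metric.toPseudoRiemannianMetric.secondFundamentalForm (𝓡 n) f νf x = Dt.kBilin x)
    (hmax : Dt.IsMaximalData) [Dt.metric.HasLeviCivita] (x : X) :
    Dt.metric.scalarCurvature x = Dt.normSqK x :=
  (𝒟.isVacuumConstraintSolution_leaf f νf hEmb hNormal Dt hh hk).scalarCurvature_eq_normSqK_of_isMaximalData
    hmax x

/-- **A maximal leaf of a vacuum Cauchy development has nonnegative scalar curvature**,
`R(h) = |k|²_h ≥ 0` — the pointwise sign at the start of the proof of Isenberg–Mazzeo–Pollack's
no-maximal-slice theorem (Ann. Henri Poincaré 4 (2003) 369, p. 371 and Thm. 4): on a data manifold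
`X` carrying no complete, one-ended asymptotically flat metric of nonnegative scalar curvature
(`X = Σ ∖ {p}`, `Σ` closed non-PSC, by the Schoen–Yau compactification argument of Thm. 4) no
vacuum development has a complete asymptotically flat maximal leaf. [cite: IsenbergMazzeoPollack2002, p. 371] -/
theorem scalarCurvature_nonneg_leaf (𝒟 : VacuumCauchyDevelopment D) (f : X → 𝒟.carrier)
    (νf : NormalField (𝓡 (n + 1)) f) (hEmb : Manifold.IsSmoothEmbedding (𝓡 n) (𝓡 (n + 1)) ∞ f)
    (hNormal : 𝒟.metric.IsFutureUnitNormal (𝓡 n) 𝒟.timeOrientation f νf)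
    (Dt : InitialDataSet (𝓡 n) X)
    (hh : ∀ (x : X) (v w : TangentSpace (𝓡 n) x), Dt.h.inner x v w =
      𝒟.metric.val (f x) (mfderiv (𝓡 n) (𝓡 (n + 1)) f x v) (mfderiv (𝓡 n) (𝓡 (n + 1)) f x w))
    (hk : ∀ [𝒟.metric.toPseudoRiemannianMetric.HasLeviCivita] (x : X),
      𝒟.metric.toPseudoRiemannianMetric.secondFundamentalForm (𝓡 n) f νf x = Dt.kBilin x)
    (hmax : Dt.IsMaximalData) [Dt.metric.HasLeviCivita] (x : X) :
    0 ≤ Dt.metric.scalarCurvature x :=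
  (𝒟.isVacuumConstraintSolution_leaf f νf hEmb hNormal Dt hh hk).scalarCurvature_nonneg_of_isMaximalData
    hmax x

end VacuumCauchyDevelopment

end Literature.Geometry.Lorentzian

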